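import Summits.QuantumAdvantage.QuantumAdvantage.Theorems.LinnikCubicClassGroupsDegreeOnePrimesEscapeClassPNTFamilyZeroSum
import Literature.NumberTheory.LFunctions.EntireZeroSumWindow
import HarnessLib

/-!
# Prime ideals of a class in short intervals, I: the zero terms of the whole family against a
# window weight

Topic `Summits/QuantumAdvantage/QuantumAdvantage/Theorems`, cell B2b-1 (linnik-cubic), PART A (gen 5);
helper for the crux `DegreeOnePrimesEscape` (stmt-QuantumAdvantage-11543) of route
`LinnikCubicClassGroups`.  HONEST FRAMING: the value of this file is a THEOREM (kernel-checked lemma)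
— NOT summit progress (the route still rests on the hypothesis-type target `PureCubicClassNumberHard`).

This is the short-interval companion of `…ClassPNTFamilyZeroSum.lean`: for a number field `K` of degree
`n > 1`, the family `F_ψ` (`ψ ∈ Ĉl_K`; `F_0 = ζ₁_K`, `F_ψ = L₀(·, χ_ψ)`), the WINDOW weight
`g = windowTest lo hi ε` of `Literature/…/WindowWeight.lean` (a smoothing of the indicator of
`[lo, hi] = [log x, log(x + h)]` in `u = log n`; `X = e^{hi+ε}`, `ℓ = hi − lo + 2ε ≍ h/x`) and its
Laplace transform `F`, GIVEN the log-free density bound for the pairs `(ψ, ρ)` in `Q`-form (the shape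
of `fam_density_local`, i.e. PART A's X1 + X2 with the `ζ_K` pole term) and clause (1) of the
Landau–Page package with constant `c`:

* `fam_flatPart_le_local` — Hoheisel's mechanism: for `T₁ ≥ 1` with `e^{b(a log Q + log(T₁+4))} ≤ X^{1/2}`,
  `Σ_ψ Σ_{|γ| ≤ T₁, ¬exc, β ≥ 1/4} m_ψ(ρ) X^{β−1} ≤ 2e·D·exp(−c log X / (2(a log Q + log(T₁ + 4))))`
  (Bombieri's partial summation `LinnikZeroSum.sum_mul_rpow_le_of_density` against the density bound at
  height `T₁`, and the zero-free region off the exceptional segment) — with `T₁ = X^θ` the right side is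
  `≤ 2eD e^{−c/(6θ)}`, a SMALL CONSTANT, uniformly in `x ≥ Q^{a₀}`;
* `fam_zeroSum_window_le_local` — the zero terms off the exceptional segment:
  `Σ_ψ Σ_{ρ ∈ u ψ, ¬exc} m_ψ(ρ) ‖F(−ρ)‖ ≤ X · (ℓ · flat + ℓ · X^{−3/4} · h_K (2T₁+3) W₀(A_K + log(T₁+5))
     + (2M/ε) T₁^{−1/2} h_K W₀ (c₁ A_K + c₂))`
  (`W₀ = 512(n+1)`, `A_K = log|d_K| + 3n`), from the per-function lemma
  `EntireEF.sum_zeroTerm_window_le` (`Literature/…/EntireZeroSumWindow.lean`).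

## References

* G. Hoheisel, *Primzahlprobleme in der Analysis*, S.-B. Preuss. Akad. Wiss. (1930) 580–588.
* J. Thorner, A. Zaman, ANT 13 (2019), §4.3 (the zero sums), Thm 3.2 (log-free density). [ThornerZaman2019]
* A. Weiss, J. reine angew. Math. 338 (1983), Thm. 4.3. [Weiss1983]
-/

noncomputable section

open Complex Real MeasureTheory Set Filter Topology
open scoped NumberField nonZeroDivisors

namespace Summit.QuantumAdvantage.QuantumAdvantage.Theorems.DegreeOnePrimesEscape

open Literature.NumberTheory.LFunctions Literature.NumberTheory.LFunctions.NumberField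
  Literature.NumberTheory.LFunctions.EntireEF Literature.NumberTheory.LFunctions.WindowWeight
  Literature.NumberTheory.LFunctions.AbelianDensity Literature.NumberTheory.LFunctions.LinnikZeroSum

variable {K : Type} [Field K] [NumberField K]

/-! ### The flat finite part: Hoheisel's mechanism -/

set_option maxHeartbeats 800000 in
/-- **The flat finite part of the zero sum of the family** (Bombieri's partial summation against the
log-free density at height `T₁`, and the zero-free region off the exceptional segment): with the density
bound in `Q`-form (`𝓠 = a log Q`, `a ≥ 1`), `c > 0`, clause (1) of the Landau–Page package with constant
`c`, `X > 1`, `T₁ ≥ 1` and `e^{b(a log Q + log(T₁+4))} ≤ X^{1/2}`: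
`Σ_ψ Σ_{ρ ∈ famFin ψ T₁, ¬exc, β ≥ 1/4} m X^{β−1} ≤ 2e D exp(−c log X/(2(a log Q + log(T₁+4))))`. -/
theorem fam_flatPart_le_local {b D a : ℝ} (hb : 0 < b) (hD : 0 < D) (ha : 1 ≤ a)
    (hK : 1 < Module.finrank ℚ K)
    (hdens : ∀ (T : ℝ), 1 ≤ T → ∀ u : AddChar (Additive (ClassGroup (𝓞 K))) ℂ → Finset ℂ,
        (∀ ψ, ∀ ρ ∈ u ψ, famF K ψ ρ = 0 ∧ 1 / 4 ≤ ρ.re ∧ ρ.re < 1 ∧ |ρ.im| ≤ T) →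
        ∀ α : ℝ, α ≤ 1 →
          ∑ ψ, ∑ ρ ∈ u ψ with α ≤ ρ.re, (famMult K ψ ρ : ℝ) ≤
            D * Real.exp (b * (a * Real.log (ThornerZaman.condQn K) + Real.log (T + 4))) ^ (1 - α))
    {c : ℝ} (hc : 0 < c)
    (hpack : ∀ (χ : ClassGroup (𝓞 K) →* ℂˣ) (ρ : ℂ),
      (((χ = 1 → dedekindZeta₁ K ρ = 0) ∧ (χ ≠ 1 → classGroupLFunction₀ K χ ρ = 0)) ∧
        1 - c / (Real.log ((NumberField.discr K).natAbs : ℝ) + Real.log (|ρ.im| + 4)) < ρ.re) →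
        ρ.im = 0 ∧ χ * χ = 1)
    {X T₁ : ℝ} (hX : 1 < X) (hT₁ : 1 ≤ T₁)
    (hrange : Real.exp (b * (a * Real.log (ThornerZaman.condQn K) + Real.log (T₁ + 4))) ≤
      X ^ ((1 : ℝ) / 2)) :
    ∑ ψ, ∑ ρ ∈ famFin K ψ T₁ with (¬ excRegion c K ρ ∧ 1 / 4 ≤ ρ.re),
        (famMult K ψ ρ : ℝ) * X ^ (ρ.re - 1) ≤
      2 * Real.exp 1 * D *
        Real.exp (-(c * Real.log X / (2 * (a * Real.log (ThornerZaman.condQn K) + Real.log (T₁ + 4))))) := by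
  classical
  set Q : ℝ := ThornerZaman.condQn K with hQ
  have hQ12 : (12 : ℝ) ≤ Q := ThornerZaman.twelve_le_condQn (K := K) hK
  have hlogQ : 0 ≤ Real.log Q := Real.log_nonneg (by linarith)
  have hX0 : 0 < X := by linarith
  have hlogT : 0 ≤ Real.log (T₁ + 4) := Real.log_nonneg (by linarith)
  set 𝓛 : ℝ := a * Real.log Q + Real.log (T₁ + 4) with h𝓛
  have h𝓛pos : 0 < 𝓛 := by
    have : Real.log 12 ≤ Real.log Q := Real.log_le_log (by norm_num) hQ12
    have h12 : 0 < Real.log 12 := Real.log_pos (by norm_num)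
    rw [h𝓛]; nlinarith
  set B : ℝ := Real.exp (b * 𝓛) with hB
  have hB1 : 1 ≤ B := Real.one_le_exp (by positivity)
  have hsqrt_lt : X ^ ((1 : ℝ) / 2) < X := by
    conv_rhs => rw [← Real.rpow_one X]
    exact Real.rpow_lt_rpow_of_exponent_lt hX (by norm_num)
  have hBX : B < X := lt_of_le_of_lt hrange hsqrt_lt
  set η : ℝ := c / 𝓛 with hη
  have hη0 : 0 < η := div_pos hc h𝓛pos
  set Fin' : AddChar (Additive (ClassGroup (𝓞 K))) ℂ → Finset ℂ := fun ψ ↦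
    (famFin K ψ T₁).filter (fun ρ ↦ ¬ excRegion c K ρ ∧ 1 / 4 ≤ ρ.re) with hFin'
  set s : Finset (Σ _ : AddChar (Additive (ClassGroup (𝓞 K))) ℂ, ℂ) := Finset.univ.sigma Fin' with hs
  have hmem : ∀ i ∈ s, (famF K i.1 i.2 = 0 ∧ 0 < i.2.re ∧ i.2.re < 1) ∧ |i.2.im| ≤ T₁ ∧
      ¬ excRegion c K i.2 ∧ 1 / 4 ≤ i.2.re := by
    rintro ⟨ψ, ρ⟩ hi
    rw [hs, Finset.mem_sigma] at hi
    obtain ⟨-, hρ⟩ := hi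
    rw [hFin'] at hρ; dsimp only at hρ
    rw [Finset.mem_filter, mem_famFin] at hρ
    exact ⟨hρ.1.1, hρ.1.2, hρ.2.1, hρ.2.2⟩
  have hconv : ∑ ψ, ∑ ρ ∈ famFin K ψ T₁ with (¬ excRegion c K ρ ∧ 1 / 4 ≤ ρ.re),
      (famMult K ψ ρ : ℝ) * X ^ (ρ.re - 1) =
      ∑ i ∈ s, (famMult K i.1 i.2 : ℝ) * X ^ (i.2.re - 1) := by
    rw [hs, Finset.sum_sigma]
  rw [hconv]
  -- the zero-free region off the exceptional segment, with `𝓛 ≥ log|d_K| + log(|γ|+4)`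
  have hzfr : ∀ i ∈ s, i.2.re ≤ 1 - η := by
    intro i hi
    obtain ⟨⟨h0, -, -⟩, hγ, hexc, -⟩ := hmem i hi
    have h1 := re_le_of_not_excRegion hpack i.1 h0 hexc
    have hd0 : (0 : ℝ) < ((NumberField.discr K).natAbs : ℝ) := by
      exact_mod_cast Nat.pos_of_ne_zero (Int.natAbs_ne_zero.2 (NumberField.discr_ne_zero K))
    have hdQ : Real.log ((NumberField.discr K).natAbs : ℝ) ≤ a * Real.log Q := by
      have h2 := Real.log_le_log hd0 (natAbs_discr_le_condQn K)
      rw [← hQ] at h2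
      nlinarith
    have hlog4 : 0 < Real.log (|i.2.im| + 4) := Real.log_pos (by linarith [abs_nonneg i.2.im])
    have hlogd : 0 ≤ Real.log ((NumberField.discr K).natAbs : ℝ) := Real.log_natCast_nonneg _
    have hγ' : Real.log (|i.2.im| + 4) ≤ Real.log (T₁ + 4) :=
      Real.log_le_log (by linarith [abs_nonneg i.2.im]) (by linarith)
    have : η ≤ c / (Real.log ((NumberField.discr K).natAbs : ℝ) + Real.log (|i.2.im| + 4)) := by
      rw [hη]
      exact div_le_div_of_nonneg_left hc.le (by linarith) (by rw [h𝓛]; linarith)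
    linarith
  -- the density bound at height `T₁`
  have hdens' : ∀ α : ℝ, α ≤ 1 - η →
      ∑ i ∈ s with α ≤ i.2.re, (famMult K i.1 i.2 : ℝ) ≤ D * B ^ (1 - α) := by
    intro α hα
    have hd' := hdens T₁ hT₁ Fin' (fun ψ ρ hρ ↦ ?_) α (by linarith)
    · refine le_of_eq_of_le ?_ (le_of_le_of_eq hd' (by rw [hB, h𝓛]))
      rw [hs]
      rw [show (∑ i ∈ (Finset.univ.sigma Fin') with α ≤ i.2.re, (famMult K i.1 i.2 : ℝ)) =
          ∑ i ∈ Finset.univ.sigma (fun ψ ↦ (Fin' ψ).filter (fun ρ ↦ α ≤ ρ.re)),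
            (famMult K i.1 i.2 : ℝ) by
        refine Finset.sum_congr ?_ fun _ _ ↦ rfl
        ext ⟨ψ, ρ⟩
        simp only [Finset.mem_filter, Finset.mem_sigma, Finset.mem_univ, true_and]]
      rw [Finset.sum_sigma]
    · rw [hFin'] at hρ; dsimp only at hρ
      rw [Finset.mem_filter, mem_famFin] at hρ
      exact ⟨hρ.1.1.1, hρ.2.2, hρ.1.1.2.2, hρ.1.2⟩
  have hbomb := sum_mul_rpow_le_of_density s (fun i ↦ i.2.re) (fun i ↦ (famMult K i.1 i.2 : ℝ))
    hB1 hBX hD.le (fun i _ ↦ Nat.cast_nonneg _) hzfr hdens'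
  -- `(B/X)^η ≤ exp(−η log X/2)` and `log X/log(X/B) ≤ 2`
  have hB0 : 0 < B := by linarith
  have hratio : Real.log X / Real.log (X / B) ≤ 2 := by
    have hlogB : Real.log B ≤ Real.log X / 2 := by
      have := Real.log_le_log hB0 hrange
      rw [hB, h𝓛, Real.log_rpow hX0] at this
      rw [hB]; linarith
    have hLX : 0 < Real.log X := Real.log_pos hX
    rw [Real.log_div hX0.ne' hB0.ne', div_le_iff₀ (by linarith)]
    linarith
  have hpow : (B / X) ^ η ≤ Real.exp (-(η * Real.log X / 2)) := by
    have h1 : B / X ≤ X ^ (-(1 : ℝ) / 2) := by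
      rw [div_le_iff₀ hX0, show X ^ (-(1:ℝ) / 2) * X = X ^ ((1 : ℝ) / 2) by
        rw [← Real.rpow_add_one hX0.ne']; norm_num]
      exact hrange
    calc (B / X) ^ η ≤ (X ^ (-(1 : ℝ) / 2)) ^ η := Real.rpow_le_rpow (by positivity) h1 hη0.le
      _ = Real.exp (-(η * Real.log X / 2)) := by
          rw [← Real.rpow_mul hX0.le, Real.rpow_def_of_pos hX0]; ring_nf
  have hgoal : Real.exp (-(c * Real.log X / (2 * (a * Real.log (ThornerZaman.condQn K) + Real.log (T₁ + 4))))) =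
      Real.exp (-(η * Real.log X / 2)) := by
    rw [hη, h𝓛, hQ]; congr 1; field_simp
  rw [hgoal]
  refine hbomb.trans ?_
  have h0 : 0 ≤ Real.exp 1 * D * (B / X) ^ η := by positivity
  calc Real.exp 1 * D * (B / X) ^ η * (Real.log X / Real.log (X / B))
      ≤ Real.exp 1 * D * (B / X) ^ η * 2 := mul_le_mul_of_nonneg_left hratio h0
    _ ≤ Real.exp 1 * D * Real.exp (-(η * Real.log X / 2)) * 2 :=
        mul_le_mul_of_nonneg_right (mul_le_mul_of_nonneg_left hpow (by positivity)) (by norm_num)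
    _ = _ := by ring

/-! ### The whole zero sum against the window weight -/

set_option maxHeartbeats 1600000 in
/-- **The zero terms of the family against a window weight, off the exceptional segment.**  With the
density bound in `Q`-form (constants `b, D, a`), clause (1) of the Landau–Page package with constant
`c > 0`, the window `g = windowTest lo hi ε` (`0 < ε < lo < hi`), `X = e^{hi+ε}`, `ℓ = hi − lo + 2ε`,
a height `T₁ ≥ 1` with `e^{b(a log Q + log(T₁+4))} ≤ X^{1/2}`, and finite sets `u ψ` of non-trivial zeros
of `F_ψ`:
`Σ_ψ Σ_{ρ ∈ u ψ, ¬exc} m_ψ(ρ) ‖F(−ρ)‖ ≤ X·(ℓ·2eD e^{−c log X/(2(a log Q + log(T₁+4)))}`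
`+ ℓ X^{−3/4} h_K (2T₁+3) W₀ (A_K + log(T₁+5)) + (2M/ε) T₁^{−1/2} h_K W₀ (c₁ A_K + c₂))`,
`W₀ = 512(n+1)`, `A_K = log|d_K| + 3n`. -/
theorem fam_zeroSum_window_le_local {b D a : ℝ} (hb : 0 < b) (hD : 0 < D) (ha : 1 ≤ a)
    (hK : 1 < Module.finrank ℚ K)
    (hdens : ∀ (T : ℝ), 1 ≤ T → ∀ u : AddChar (Additive (ClassGroup (𝓞 K))) ℂ → Finset ℂ,
        (∀ ψ, ∀ ρ ∈ u ψ, famF K ψ ρ = 0 ∧ 1 / 4 ≤ ρ.re ∧ ρ.re < 1 ∧ |ρ.im| ≤ T) →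
        ∀ α : ℝ, α ≤ 1 →
          ∑ ψ, ∑ ρ ∈ u ψ with α ≤ ρ.re, (famMult K ψ ρ : ℝ) ≤
            D * Real.exp (b * (a * Real.log (ThornerZaman.condQn K) + Real.log (T + 4))) ^ (1 - α))
    {c : ℝ} (hc : 0 < c)
    (hpack : ∀ (χ : ClassGroup (𝓞 K) →* ℂˣ) (ρ : ℂ),
      (((χ = 1 → dedekindZeta₁ K ρ = 0) ∧ (χ ≠ 1 → classGroupLFunction₀ K χ ρ = 0)) ∧
        1 - c / (Real.log ((NumberField.discr K).natAbs : ℝ) + Real.log (|ρ.im| + 4)) < ρ.re) →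
        ρ.im = 0 ∧ χ * χ = 1)
    {M : ℝ} (hM : ∀ y : ℝ, |iteratedDeriv 1 Real.smoothTransition y| ≤ M ∧ |iteratedDeriv 2 Real.smoothTransition y| ≤ M)
    {lo hi ε : ℝ} (hε : 0 < ε) (hεlo : ε < lo) (hlohi : lo < hi) {T₁ : ℝ} (hT₁ : 1 ≤ T₁)
    (hrange : Real.exp (b * (a * Real.log (ThornerZaman.condQn K) + Real.log (T₁ + 4))) ≤
      Real.exp (hi + ε) ^ ((1 : ℝ) / 2))
    (u : AddChar (Additive (ClassGroup (𝓞 K))) ℂ → Finset ℂ)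
    (hu : ∀ ψ, ∀ ρ ∈ u ψ, famF K ψ ρ = 0 ∧ 0 < ρ.re ∧ ρ.re < 1) :
    ∑ ψ, ∑ ρ ∈ u ψ with ¬ excRegion c K ρ,
        (famMult K ψ ρ : ℝ) * ‖fordLaplace (windowTest lo hi ε) (-ρ)‖ ≤
      Real.exp (hi + ε) *
        ((hi - lo + 2 * ε) * (2 * Real.exp 1 * D *
            Real.exp (-(c * (hi + ε) / (2 * (a * Real.log (ThornerZaman.condQn K) + Real.log (T₁ + 4)))))) +
          (hi - lo + 2 * ε) * Real.exp (hi + ε) ^ (-(3 : ℝ) / 4) *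
            ((NumberField.classNumber K : ℝ) * ((2 * T₁ + 3) *
              ((512 * (Module.finrank ℚ K + 1)) *
                ((Real.log ((NumberField.discr K).natAbs : ℝ) + 3 * Module.finrank ℚ K) + Real.log (T₁ + 5))))) +
          (2 * M / ε) * T₁ ^ (-((1 : ℝ) / 2)) *
            ((NumberField.classNumber K : ℝ) * ((512 * (Module.finrank ℚ K + 1)) *
              (tailConst₁ * (Real.log ((NumberField.discr K).natAbs : ℝ) + 3 * Module.finrank ℚ K) + tailConst₂)))) := by
  classical
  obtain ⟨hc₁16, hc₂0⟩ := tailConst_nonneg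
  set X : ℝ := Real.exp (hi + ε) with hX
  have hX0 : 0 < X := Real.exp_pos _
  have hX1 : 1 < X := by rw [hX]; exact Real.one_lt_exp_iff.2 (by linarith)
  set ℓ : ℝ := hi - lo + 2 * ε with hℓ
  have hℓ0 : 0 ≤ ℓ := by rw [hℓ]; linarith
  have hM0 : 0 ≤ M := le_trans (abs_nonneg _) (hM 0).1
  set W₀ : ℝ := 512 * ((Module.finrank ℚ K : ℝ) + 1) with hW₀
  have hW₀0 : 0 ≤ W₀ := by positivity
  set A : ℝ := Real.log ((NumberField.discr K).natAbs : ℝ) + 3 * Module.finrank ℚ K with hAdef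
  have hAnn : 0 ≤ A := by have := Real.log_natCast_nonneg (NumberField.discr K).natAbs; positivity
  have hwin : ∀ ψ (τ : ℝ) (P : Finset ℂ), (∀ ρ ∈ P, famF K ψ ρ = 0 ∧ 0 < ρ.re ∧ ρ.re < 1 ∧ |ρ.im - τ| ≤ 1 / 2) →
      ∑ ρ ∈ P, (analyticOrderNatAt (famF K ψ) ρ : ℝ) ≤ W₀ * (A + Real.log (|τ| + 4)) := by
    intro ψ τ P hP
    have := fam_window ψ τ P hP
    convert this using 2
  -- (A) per character
  set g : AddChar (Additive (ClassGroup (𝓞 K))) ℂ → ℂ → ℝ := fun ψ ρ ↦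
    (famMult K ψ ρ : ℝ) * ‖fordLaplace (windowTest lo hi ε) (-ρ)‖ with hg
  set S : AddChar (Additive (ClassGroup (𝓞 K))) ℂ → ℝ := fun ψ ↦
    ∑ ρ ∈ famFin K ψ T₁ with (¬ excRegion c K ρ ∧ 1 / 4 ≤ ρ.re),
      (famMult K ψ ρ : ℝ) * X ^ (ρ.re - 1) with hS
  set J : ℝ := ℓ * X ^ (-(3 : ℝ) / 4) * ((2 * T₁ + 3) * (W₀ * (A + Real.log (T₁ + 5)))) +
    (2 * M / ε) * T₁ ^ (-((1 : ℝ) / 2)) * (W₀ * (tailConst₁ * A + tailConst₂)) with hJ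
  have hper : ∀ ψ, ∑ ρ ∈ u ψ with ¬ excRegion c K ρ, g ψ ρ ≤ X * (ℓ * S ψ + J) := by
    intro ψ
    have hdp : DecidablePred (· ∈ nontrivialZeros (famF K ψ)) := fun _ ↦ Classical.propDecidable _
    set Exc : Finset ℂ := (famFin K ψ T₁ ∪ u ψ).filter (excRegion c K) with hExc
    set u' : Finset (nontrivialZeros (famF K ψ)) :=
      ((u ψ).filter (fun ρ ↦ ¬ excRegion c K ρ)).subtype (· ∈ nontrivialZeros (famF K ψ)) with hu'
    have key := sum_zeroTerm_window_le (differentiable_famF ψ) (famF_two_ne_zero ψ) (W := W₀) (A := A)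
      hW₀0 hAnn (hwin ψ) hM hε hεlo hlohi hT₁ Exc u'
    -- the left side
    have h1 : u'.filter (fun ρ' : nontrivialZeros (famF K ψ) ↦ (ρ' : ℂ) ∉ Exc) = u' := by
      refine Finset.filter_true_of_mem fun ρ' hρ' ↦ ?_
      rw [hu', Finset.mem_subtype, Finset.mem_filter] at hρ'
      rw [hExc, Finset.mem_filter, not_and_or]
      exact Or.inr hρ'.2
    rw [h1] at key
    have hLHS : ∑ ρ' ∈ u', (analyticOrderNatAt (famF K ψ) (ρ' : ℂ) : ℝ) *
        ‖fordLaplace (windowTest lo hi ε) (-(ρ' : ℂ))‖ =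
        ∑ ρ ∈ u ψ with ¬ excRegion c K ρ, g ψ ρ := by
      rw [hu', Finset.sum_subtype_of_mem (fun ρ : ℂ ↦ (analyticOrderNatAt (famF K ψ) ρ : ℝ) *
        ‖fordLaplace (windowTest lo hi ε) (-ρ)‖)]
      · exact Finset.sum_congr rfl fun _ _ ↦ rfl
      intro ρ hρ
      rw [Finset.mem_filter] at hρ
      exact hu ψ ρ hρ.1
    rw [hLHS] at key
    refine key.trans ?_
    refine mul_le_mul_of_nonneg_left ?_ hX0.le
    rw [add_assoc]
    refine add_le_add ?_ ?_
    · -- the flat part: the filter `ρ ∉ Exc` is `¬ excRegion` on `famFin`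
      refine mul_le_mul_of_nonneg_left (le_of_eq ?_) hℓ0
      rw [hS]; dsimp only
      change ∑ ρ ∈ (famFin K ψ T₁).filter (fun ρ ↦ ρ ∉ Exc ∧ 1 / 4 ≤ ρ.re), _ = _
      refine Finset.sum_congr (Finset.filter_congr fun ρ hρ ↦ ?_) fun _ _ ↦ rfl
      rw [hExc, Finset.mem_filter, not_and_or]
      constructor
      · rintro ⟨h | h, h14⟩
        · exact absurd (Finset.mem_union_left _ hρ) h
        · exact ⟨h, h14⟩
      · rintro ⟨h, h14⟩; exact ⟨Or.inr h, h14⟩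
    · -- the junk of `ψ`
      rw [hJ]
      refine add_le_add (mul_le_mul_of_nonneg_left ?_ ?_) le_rfl
      · change ∑ ρ ∈ famFin K ψ T₁, (analyticOrderNatAt (famF K ψ) ρ : ℝ) ≤ _
        refine sum_mult_le_of_window hW₀0 hAnn (hwin ψ) (by linarith) _ fun ρ hρ ↦ ?_
        rw [mem_famFin] at hρ
        exact ⟨hρ.1.1, hρ.1.2.1, hρ.1.2.2, hρ.2⟩
      · positivity
  -- (B) sum over `ψ`
  have hsum : ∑ ψ, ∑ ρ ∈ u ψ with ¬ excRegion c K ρ, g ψ ρ ≤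
      X * (ℓ * ∑ ψ, S ψ + (NumberField.classNumber K : ℝ) * J) := by
    refine (Finset.sum_le_sum fun ψ _ ↦ hper ψ).trans (le_of_eq ?_)
    rw [← Finset.mul_sum, Finset.sum_add_distrib, Finset.mul_sum, Finset.sum_const, nsmul_eq_mul,
      Finset.card_univ, card_addChar_classGroup]
  -- (C) the flat part by density + ZFR
  have hflat := fam_flatPart_le_local hb hD ha hK hdens hc hpack hX1 hT₁ hrange
  have hlogX : Real.log X = hi + ε := by rw [hX, Real.log_exp]
  rw [hlogX] at hflat
  -- (D) assemble
  have hgoal : ∑ ψ, ∑ ρ ∈ u ψ with ¬ excRegion c K ρ,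
      (famMult K ψ ρ : ℝ) * ‖fordLaplace (windowTest lo hi ε) (-ρ)‖ =
      ∑ ψ, ∑ ρ ∈ u ψ with ¬ excRegion c K ρ, g ψ ρ := by rw [hg]
  rw [hgoal]
  refine hsum.trans ?_
  have hS0 : 0 ≤ ∑ ψ, S ψ := Finset.sum_nonneg fun ψ _ ↦ by
    rw [hS]; exact Finset.sum_nonneg fun ρ _ ↦ mul_nonneg (Nat.cast_nonneg _) (Real.rpow_nonneg hX0.le _)
  have hh0 : (0 : ℝ) ≤ (NumberField.classNumber K : ℝ) := Nat.cast_nonneg _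
  have hflat' : ℓ * ∑ ψ, S ψ ≤ ℓ * (2 * Real.exp 1 * D *
      Real.exp (-(c * (hi + ε) / (2 * (a * Real.log (ThornerZaman.condQn K) + Real.log (T₁ + 4)))))) :=
    mul_le_mul_of_nonneg_left hflat hℓ0
  refine mul_le_mul_of_nonneg_left ?_ hX0.le
  have e : (NumberField.classNumber K : ℝ) * J =
      ℓ * X ^ (-(3 : ℝ) / 4) *
          ((NumberField.classNumber K : ℝ) * ((2 * T₁ + 3) *
            ((512 * (Module.finrank ℚ K + 1)) *
              ((Real.log ((NumberField.discr K).natAbs : ℝ) + 3 * Module.finrank ℚ K) + Real.log (T₁ + 5))))) +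
        (2 * M / ε) * T₁ ^ (-((1 : ℝ) / 2)) *
          ((NumberField.classNumber K : ℝ) * ((512 * (Module.finrank ℚ K + 1)) *
            (tailConst₁ * (Real.log ((NumberField.discr K).natAbs : ℝ) + 3 * Module.finrank ℚ K) + tailConst₂))) := by
    rw [hJ, hW₀, hAdef]; ring
  rw [hℓ] at hflat' e ⊢
  linarith [hflat', e]

end Summit.QuantumAdvantage.QuantumAdvantage.Theorems.DegreeOnePrimesEscape

end
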